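import Mathlib
import HarnessLib
import Summits.Langlands.Langlands.Theorems.SkinnerWilesDefectOneEisensteinProModularSeedInertSupplyPrimeSq

/-!
# Item `SeedOfQuadraticBaseChange` (stmt-Langlands-15158): inert level-raising primes
# `M ≡ -1 (mod p²)` in the class of complex conjugation, for EVERY prime `p` (stub S1' without `p ≥ 5`)

The landed stub S1' `EisensteinProModularSeed.stub_inertSupplyPrimeSq` (p92220) of the seed's line
`descend-raise-basechange` is registered with the hypothesis `5 ≤ p` (the line's regime at the time)
but its proof never uses it: for `F` imaginary quadratic, ANY prime `p` and a continuous unit-valued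
`η : Γ_ℚ → ℚ̄_pˣ` with `η̄(c) ≡ -1` at complex conjugations, Chebotarev in the class of a complex
conjugation `c` of the finite extension cut out by (the residual kernel of `η`, `χ_{p²}`, `F`)
(`exists_inert_prime_modN`, fed by the tree's proved `chebotarev_artinRep_holds`) supplies a prime
`M ≠ p`, INERT in `F`, at which `η̄` is unramified, with `η̄(Frob_M) ≡ η̄(c) ≡ -1` at every
arithmetic Frobenius above `M` and `M ≡ χ_{p²}(c) = -1 (mod p²)`.  This file records that
statement for every `p` (`inertSupplyPrimeSq_all`), with the landed proof word for word; it is the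
`p = 3` input of the odd-prime extension of the line (companion files
`…SeedOfQuadraticBaseChangeEisensteinPackageQOdd`, `…SeedOfQuadraticBaseChangeOddPrimes`).
References: Billerey–Menares, Math. Res. Lett. 23 (2016), Thm. 2.2 (the use of such `M`); Tate,
*Global class field theory* §2.4 (Chebotarev).
-/

set_option linter.dupNamespace false -- project-wide option (lakefile weak.linter.dupNamespace); `Summit.Langlands.Langlands` is the mandated namespace

noncomputable section

open Field NumberField IsDedekindDomain
open scoped Pointwise
open Literature.NumberTheory.GaloisRepresentations

namespace Summit.Langlands.Langlands.Theorems.SkinnerWilesDefectOne.SeedOfQuadraticBaseChange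

open Summit.Langlands.Langlands.Theorems.SkinnerWilesDefectOne.EisensteinProModularSeed

/-- **Inert level-raising primes `M ≡ -1 (mod p²)` with `η̄(Frob_M) = -1`, for every prime `p`.**
`F` imaginary quadratic, `p` any prime, `η : Γ_ℚ → ℚ̄_pˣ` continuous and unit-valued with
`η̄(c) ≡ -1` at every complex conjugation `c`: there is a prime `M ≠ p`, INERT in `F` (`M 𝓞_F`
prime), at which `η̄` is unramified, with `η̄(Frob_M) ≡ -1` at every arithmetic Frobenius above `M`
and `M ≡ -1 (mod p²)`.  The landed `stub_inertSupplyPrimeSq` is the case `5 ≤ p`; same proof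
(Chebotarev for the residual kernel of `η`, modulus `p²`, the class of a complex conjugation).
[folklore] -/
theorem inertSupplyPrimeSq_all :
    ∀ (F : Type) [Field F] [NumberField F], NumberField.IsTotallyComplex F → Module.finrank ℚ F = 2 →
      ∀ (p : ℕ) [Fact p.Prime],
      ∀ (η : Field.absoluteGaloisGroup ℚ →ₜ* (PadicAlgCl p)ˣ),
      (∀ τ, Valued.v ((η τ : (PadicAlgCl p)ˣ) : PadicAlgCl p) = 1) →
      (∀ c : Field.absoluteGaloisGroup ℚ, Literature.NumberTheory.GaloisRepresentations.IsComplexConjugation (Rat.castHom ℝ) c →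
        Valued.v (((η c : (PadicAlgCl p)ˣ) : PadicAlgCl p) + 1) < 1) →
      ∃ M : ℕ, M.Prime ∧ M ≠ p ∧ (Ideal.span {(M : NumberField.RingOfIntegers F)}).IsPrime ∧
        (∀ w : IsDedekindDomain.HeightOneSpectrum (NumberField.RingOfIntegers ℚ), (M : NumberField.RingOfIntegers ℚ) ∈ w.asIdeal → ∀ 𝔓 ∈ w.primesAbove,
          ∀ σ ∈ 𝔓.inertia (Field.absoluteGaloisGroup ℚ),
            Valued.v (((η σ : (PadicAlgCl p)ˣ) : PadicAlgCl p) - 1) < 1) ∧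
        (∀ w : IsDedekindDomain.HeightOneSpectrum (NumberField.RingOfIntegers ℚ), (M : NumberField.RingOfIntegers ℚ) ∈ w.asIdeal → ∀ 𝔓 ∈ w.primesAbove,
          ∀ σ : Field.absoluteGaloisGroup ℚ, IsArithFrobAt (NumberField.RingOfIntegers ℚ) σ 𝔓 →
            Valued.v (((η σ : (PadicAlgCl p)ˣ) : PadicAlgCl p) + 1) < 1) ∧
        M % (p ^ 2) = p ^ 2 - 1 := by
  intro F _ _ hF h2 p _ η hunit hodd
  classical
  haveI : NeZero p := ⟨(Fact.out : p.Prime).ne_zero⟩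
  haveI hN0 : NeZero (p ^ 2) := inferInstance
  haveI : NeZero ((p ^ 2 : ℕ) : ℚ) := NeZero.charZero
  haveI : FiniteDimensional ℚ F := Module.finite_of_finrank_eq_succ h2
  haveI : Algebra.IsQuadraticExtension ℚ F := ⟨h2⟩
  haveI : IsGalois ℚ F := inferInstance
  obtain ⟨Hη, hHη, hHηn, hHηo⟩ := exists_residualKernel η hunit
  haveI := hHηn
  set ω := modNCyclotomicCharacter ℚ (p ^ 2) with hω
  -- a Frobenius in the class of complex conjugation, modulo `p²`
  obtain ⟨c, hc⟩ := exists_isComplexConjugation (K := ℚ) (Rat.castHom ℝ)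
  have hcF := Rat.not_mem_range_absGaloisRestrict_of_isComplexConjugation F hF hc
  obtain ⟨M, v, hMprime, hMv, hNv, huniqv, hspan, hIN, hωg, 𝔓, h𝔓, σ, hσ, hσN⟩ :=
    exists_inert_prime_modN F h2 (p ^ 2) Hη hHηo hcF
  have hωc : (ω c : ZMod (p ^ 2)) = -1 := modNCyclotomicCharacter_of_isComplexConjugation hc
  -- `M ≠ p` since `v ∤ p²`
  have hMp : M ≠ p := fun h => hNv (by
    rw [Nat.cast_pow, sq, ← h]
    exact v.asIdeal.mul_mem_left _ hMv)
  -- `M ≡ -1 (mod p²)`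
  have hMmod : M % (p ^ 2) = p ^ 2 - 1 := by
    have hM1 : (M : ZMod (p ^ 2)) = ((p ^ 2 - 1 : ℕ) : ZMod (p ^ 2)) := by
      rw [← hωg, ← hω, hωc, Nat.cast_sub NeZero.one_le, ZMod.natCast_self, Nat.cast_one, zero_sub]
    have h := (ZMod.natCast_eq_natCast_iff' M (p ^ 2 - 1) (p ^ 2)).mp hM1
    rwa [Nat.mod_eq_of_lt (Nat.sub_lt (NeZero.pos (p ^ 2)) one_pos)] at h
  refine ⟨M, hMprime, hMp, hspan, ?_, ?_, hMmod⟩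
  · -- unramified: inertia above `M` lies in the residual kernel
    intro w hw 𝔓' h𝔓' i hi
    obtain rfl := huniqv w hw
    exact (hHη i).mp (hIN 𝔓' h𝔓' hi)
  · -- `η̄(Frob) = η̄(c) = -1` at every arithmetic Frobenius above `M`
    intro w hw 𝔓' h𝔓' σ' hσ'
    obtain rfl := huniqv w hw
    -- transport the Frobenius `σ` at `𝔓` to `𝔓'`
    obtain ⟨τ, hτ⟩ := HeightOneSpectrum.exists_smul_eq_of_mem_primesAbove_holds h𝔓 h𝔓'
    have hconj : IsArithFrobAt (𝓞 ℚ) (τ * σ * τ⁻¹) 𝔓' := hτ ▸ hσ.conj τ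
    have hi : σ' * (τ * σ * τ⁻¹)⁻¹ ∈ 𝔓'.inertia (absoluteGaloisGroup ℚ) :=
      hσ'.mul_inv_mem_inertia hconj
    have h1 := (hHη _).mp (hIN 𝔓' h𝔓' hi)
    have h2' := (hHη _).mp hσN
    have h3 := hodd c hc
    -- `η σ' = η(i) · η(c) · η(c⁻¹ σ)` in the abelian group `ℚ̄_pˣ`
    have e1 : η σ' = η (σ' * (τ * σ * τ⁻¹)⁻¹) * η (τ * σ * τ⁻¹) := by
      rw [← map_mul, inv_mul_cancel_right]
    have e2 : η (τ * σ * τ⁻¹) = η σ := by rw [map_mul, map_mul, map_inv, mul_inv_cancel_comm]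
    have e3 : η σ = η c * η (c⁻¹ * σ) := by rw [← map_mul, mul_inv_cancel_left]
    rw [e2, e3] at e1
    have hval : ((η σ' : (PadicAlgCl p)ˣ) : PadicAlgCl p) =
        ((η (σ' * (τ * σ * τ⁻¹)⁻¹) : (PadicAlgCl p)ˣ) : PadicAlgCl p) *
          (((η c : (PadicAlgCl p)ˣ) : PadicAlgCl p) * ((η (c⁻¹ * σ) : (PadicAlgCl p)ˣ) : PadicAlgCl p)) := by
      rw [e1, Units.val_mul, Units.val_mul]
    set x := ((η (σ' * (τ * σ * τ⁻¹)⁻¹) : (PadicAlgCl p)ˣ) : PadicAlgCl p) with hx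
    set y := ((η (c⁻¹ * σ) : (PadicAlgCl p)ˣ) : PadicAlgCl p) with hy
    set d := ((η c : (PadicAlgCl p)ˣ) : PadicAlgCl p) with hd
    have e : ((η σ' : (PadicAlgCl p)ˣ) : PadicAlgCl p) + 1 =
        (x - 1) * (d * y) + (d * (y - 1) + (d + 1)) := by rw [hval]; ring
    rw [e]
    refine Valuation.map_add_lt _ ?_ (Valuation.map_add_lt _ ?_ h3)
    · rw [Valuation.map_mul, Valuation.map_mul, hd, hy, hunit, hunit, mul_one, mul_one]
      exact h1
    · rw [Valuation.map_mul, hd, hunit, one_mul]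
      exact h2'


end Summit.Langlands.Langlands.Theorems.SkinnerWilesDefectOne.SeedOfQuadraticBaseChange

end
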